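import Summits.QuantumFields.YangMills.Theorems.EntropyBudgetEquipartitionScaleEntropyIdentity
import HarnessLib

/-!
# Route `EntropyBudgetEquipartition`, crux `EntropyBudgetTransfer` (stmt-QuantumFields-22401) — the Jeffreys (symmetrised) scale entropy of lattice Yang–Mills

HONEST LABEL: helper lemmas toward a RECORD-label rung (R2ξ-G, `WeakCouplingRates.XiPow`, an UPPER bound on the lattice gap);
nothing here bears on the Clay Yang–Mills mass gap, which is NOT proved by any of this.

Companion of `EntropyBudgetEquipartitionScaleEntropyIdentity.lean` (the Gibbs identity in `β`).  In the SYMMETRISED relative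
entropy the partition functions cancel, so the identity is exact in the mean actions alone and its rate needs only KT1
(`BudgetRate.budgetRate_torus`), not the convergence of the torus free energies:

* `toReal_klDiv_wilsonMeasure_symm` : `KL(μ_{Λ,β'} ‖ μ_{Λ,β}) + KL(μ_{Λ,β} ‖ μ_{Λ,β'}) = (β' − β)(⟨S⟩_{Λ,β} − ⟨S⟩_{Λ,β'})`;
* `klDiv_wilsonMeasure_symm_perSite` : the same per site with the site energy `s₀`;
* `jeffreys_rate` : K1's body ⇒ for `β₁ ≤ β ≤ β' ≤ 2β`, eventually in `L`,
  `| |Λ|⁻¹ Jeffreys(μ_{Λ,β'}, μ_{Λ,β}) − (3D/2)(β' − β)²/(β β') | ≤ C' β^{−κ/2}` (free-gluon value: `3D` Gaussian modes per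
  site, `½(λ−1)²/λ` each, `λ = β'/β`).

[FriedliVelenik2017] [folklore]
-/

noncomputable section

namespace Summit.QuantumFields.YangMills.Theorems.EntropyBudgetEquipartition.ScaleEntropy

open MeasureTheory Filter Topology InformationTheory
open Literature.MathematicalPhysics.QuantumLattice Literature.MathematicalPhysics.QuantumFieldTheory

/-! ### The symmetrised (Jeffreys) scale entropy: exact, and with rate from KT1 alone -/

section Jeffreys

variable {d L N : ℕ} {G : Type*} [Group G] [TopologicalSpace G] [IsTopologicalGroup G] [CompactSpace G]
  [MeasurableSpace G] [BorelSpace G] [SecondCountableTopology G] (ρ : G →* Matrix (Fin N) (Fin N) ℂ)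

/-- **Jeffreys form of the Gibbs identity, exact on every torus**: the partition functions cancel in the symmetrised relative
entropy, `KL(μ_{Λ,β'} ‖ μ_{Λ,β}) + KL(μ_{Λ,β} ‖ μ_{Λ,β'}) = (β' − β)(⟨S⟩_{Λ,β} − ⟨S⟩_{Λ,β'})` — in particular the mean action is
antitone in `β` (both entropies are `≥ 0`). [folklore] -/
theorem toReal_klDiv_wilsonMeasure_symm [NeZero L] (hρ : Continuous ρ) (β β' : ℝ) :
    (klDiv (wilsonMeasure (d := d) (L := L) ρ β') (wilsonMeasure (d := d) (L := L) ρ β)).toReal +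
        (klDiv (wilsonMeasure (d := d) (L := L) ρ β) (wilsonMeasure (d := d) (L := L) ρ β')).toReal =
      (β' - β) * (wilsonExpectation (d := d) (L := L) ρ β (wilsonAction ρ) -
        wilsonExpectation (d := d) (L := L) ρ β' (wilsonAction ρ)) := by
  rw [(toReal_klDiv_wilsonMeasure (d := d) (L := L) ρ hρ β β').2, (toReal_klDiv_wilsonMeasure (d := d) (L := L) ρ hρ β' β).2]
  ring

/-- **Jeffreys form, per site**: `|Λ|⁻¹ (KL(μ_{β'} ‖ μ_β) + KL(μ_β ‖ μ_{β'})) = (β' − β)(⟨s₀⟩_{M,β} − ⟨s₀⟩_{M,β'})` with `s₀` the site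
energy at the origin (translation invariance). [folklore] -/
theorem klDiv_wilsonMeasure_symm_perSite (hρ : Continuous ρ) (β β' : ℝ) (M : ℕ) [NeZero M] :
    ((M : ℝ) ^ d)⁻¹ * ((klDiv (wilsonMeasure (d := d) (L := M) ρ β') (wilsonMeasure (d := d) (L := M) ρ β)).toReal +
        (klDiv (wilsonMeasure (d := d) (L := M) ρ β) (wilsonMeasure (d := d) (L := M) ρ β')).toReal) =
      (β' - β) * (wilsonExpectation (d := d) (L := M) ρ β (toTorusObservable M fun U : LGConfig d G =>
          ∑ i : Fin d, ∑ j : Fin d, if i < j then ((N : ℝ) - plaquetteObs ρ 0 i j U) else 0) -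
        wilsonExpectation (d := d) (L := M) ρ β' (toTorusObservable M fun U : LGConfig d G =>
          ∑ i : Fin d, ∑ j : Fin d, if i < j then ((N : ℝ) - plaquetteObs ρ 0 i j U) else 0)) := by
  have hM : (0 : ℝ) < (M : ℝ) ^ d := pow_pos (Nat.cast_pos.2 (Nat.pos_of_ne_zero (NeZero.ne M))) d
  rw [toReal_klDiv_wilsonMeasure_symm (d := d) (L := M) ρ hρ β β',
    EquipartitionPinsProbe.Equipartition.wilsonExpectation_wilsonAction_eq ρ hρ β M,
    EquipartitionPinsProbe.Equipartition.wilsonExpectation_wilsonAction_eq ρ hρ β' M,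
    EquipartitionPinsProbe.Equipartition.toTorusObservable_siteEnergy ρ M]
  field_simp

end Jeffreys

section JeffreysRate

/-- Real arithmetic of the Jeffreys rate: from `|β e − c| ≤ C₁ x`, `|β' e' − c| ≤ C₁ x'` (`x' ≤ x`), `0 < β ≤ β' ≤ 2β`:
`|(β' − β)(e − e') − c (β' − β)²/(β β')| ≤ 2 C₁ x`. [folklore] -/
theorem jeffreys_arith {β β' e e' c C₁ x x' : ℝ} (hβ : 0 < β) (hββ' : β ≤ β') (h2 : β' ≤ 2 * β)
    (k1 : |β * e - c| ≤ C₁ * x) (k2 : |β' * e' - c| ≤ C₁ * x') (hx : x' ≤ x) (hC₁ : 0 ≤ C₁) :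
    |(β' - β) * (e - e') - c * ((β' - β) ^ 2 / (β * β'))| ≤ 2 * (C₁ * x) := by
  have hβ'pos : 0 < β' := lt_of_lt_of_le hβ hββ'
  -- `(β' − β)(e − e') = ((β'−β)/β)(β e) − ((β'−β)/β')(β' e')` and `c (β'−β)²/(ββ') = ((β'−β)/β) c − ((β'−β)/β') c`
  set u : ℝ := (β' - β) / β with hu
  set u' : ℝ := (β' - β) / β' with hu'
  have hu0 : 0 ≤ u := div_nonneg (by linarith) hβ.le
  have hu1 : u ≤ 1 := by rw [hu, div_le_one hβ]; linarith
  have hu'0 : 0 ≤ u' := div_nonneg (by linarith) hβ'pos.le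
  have hu'1 : u' ≤ 1 := by rw [hu', div_le_one hβ'pos]; linarith
  have e1 : (β' - β) * (e - e') = u * (β * e) - u' * (β' * e') := by
    rw [hu, hu']; field_simp
  have e2 : c * ((β' - β) ^ 2 / (β * β')) = u * c - u' * c := by
    rw [hu, hu']; field_simp
  rw [e1, e2]
  have a1 : |u * (β * e) - u * c| ≤ C₁ * x := by
    rw [← mul_sub, abs_mul, abs_of_nonneg hu0]
    calc u * |β * e - c| ≤ 1 * (C₁ * x) := mul_le_mul hu1 k1 (abs_nonneg _) zero_le_one
      _ = C₁ * x := one_mul _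
  have a2 : |u' * (β' * e') - u' * c| ≤ C₁ * x := by
    rw [← mul_sub, abs_mul, abs_of_nonneg hu'0]
    calc u' * |β' * e' - c| ≤ 1 * (C₁ * x') := mul_le_mul hu'1 k2 (abs_nonneg _) zero_le_one
      _ ≤ C₁ * x := by rw [one_mul]; exact mul_le_mul_of_nonneg_left hx hC₁
  have b1 := abs_le.1 a1
  have b2 := abs_le.1 a2
  rw [abs_le]
  constructor <;> linarith

variable {G : Type} [Group G] [TopologicalSpace G] [IsTopologicalGroup G] [CompactSpace G]
  [MeasurableSpace G] [BorelSpace G]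

/-- **Jeffreys scale entropy of lattice Yang–Mills with rate, from KT1 alone.**  IF the K1 rate
`|f_r(β) + (3D/2) log β − K| ≤ C β^{−κ}` holds for `β ≥ β₀`, THEN there are `C'`, `β₁` such that for `β₁ ≤ β ≤ β' ≤ 2β`,
eventually in the torus size `L + 1`,
`| |Λ|⁻¹ (KL(μ_{Λ,β'} ‖ μ_{Λ,β}) + KL(μ_{Λ,β} ‖ μ_{Λ,β'})) − (3D/2)(β' − β)²/(β β') | ≤ C' β^{−κ/2}` — the exact per-site Jeffreys
identity (`klDiv_wilsonMeasure_symm_perSite`, no partition functions) and KT1 (`BudgetRate.budgetRate_torus`) at `β` and `β'`.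
The free-gluon value: `3D` Gaussian modes per site, Jeffreys divergence `½(λ − 1)²/λ` each, `λ = β'/β`.  A helper toward a
RECORD-label rung crux; NOT the Clay gap. [cite: FriedliVelenik2017, ch. 6] -/
theorem jeffreys_rate (r : LatticeRep G) {D : ℕ} {K κ C β₀ : ℝ} (hκ : 0 < κ)
    (hrate : ∀ β : ℝ, β₀ ≤ β →
      |freeEnergyDensity 4 r.ρ β + (3 * (D : ℝ) / 2) * Real.log β - K| ≤ C * β ^ (-κ)) :
    ∃ C' β₁ : ℝ, ∀ β : ℝ, β₁ ≤ β → ∀ β' : ℝ, β ≤ β' → β' ≤ 2 * β → ∀ᶠ L : ℕ in atTop,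
      |((L + 1 : ℝ) ^ 4)⁻¹ *
          ((klDiv (wilsonMeasure (d := 4) (L := L + 1) r.ρ β') (wilsonMeasure (d := 4) (L := L + 1) r.ρ β)).toReal +
            (klDiv (wilsonMeasure (d := 4) (L := L + 1) r.ρ β) (wilsonMeasure (d := 4) (L := L + 1) r.ρ β')).toReal) -
        (3 * (D : ℝ) / 2) * ((β' - β) ^ 2 / (β * β'))| ≤ C' * β ^ (-(κ / 2)) := by
  haveI : SecondCountableTopology (Matrix (Fin r.N) (Fin r.N) ℂ) :=
    inferInstanceAs (SecondCountableTopology (Fin r.N → Fin r.N → ℂ))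
  haveI : SecondCountableTopology G :=
    (r.continuous.isClosedEmbedding r.injective).isEmbedding.secondCountableTopology
  obtain ⟨C₁, β₁, hKT⟩ := BudgetRate.budgetRate_torus r (D := D) hκ hrate
  refine ⟨2 * max C₁ 0, max β₁ 1, fun β hβ β' hββ' h2 => ?_⟩
  have hβ1 : β₁ ≤ β := (le_max_left _ _).trans hβ
  have hβone : (1 : ℝ) ≤ β := (le_max_right _ _).trans hβ
  have hβpos : 0 < β := by linarith
  have hβ'pos : 0 < β' := lt_of_lt_of_le hβpos hββ'
  filter_upwards [hKT β hβ1, hKT β' (hβ1.trans hββ')] with L hL hL'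
  have hper := klDiv_wilsonMeasure_symm_perSite (d := 4) r.ρ r.continuous β β' (L + 1)
  push_cast at hper
  rw [hper]
  have k1 : |β * wilsonExpectation (L := L + 1) r.ρ β (toTorusObservable (L + 1)
      fun U : LGConfig 4 G => ∑ i : Fin 4, ∑ j : Fin 4,
        if i < j then ((r.N : ℝ) - plaquetteObs r.ρ 0 i j U) else 0) - 3 * (D : ℝ) / 2| ≤
      max C₁ 0 * β ^ (-(κ / 2)) :=
    hL.trans (mul_le_mul_of_nonneg_right (le_max_left _ _) (Real.rpow_nonneg hβpos.le _))
  have k2 : |β' * wilsonExpectation (L := L + 1) r.ρ β' (toTorusObservable (L + 1)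
      fun U : LGConfig 4 G => ∑ i : Fin 4, ∑ j : Fin 4,
        if i < j then ((r.N : ℝ) - plaquetteObs r.ρ 0 i j U) else 0) - 3 * (D : ℝ) / 2| ≤
      max C₁ 0 * β' ^ (-(κ / 2)) :=
    hL'.trans (mul_le_mul_of_nonneg_right (le_max_left _ _) (Real.rpow_nonneg hβ'pos.le _))
  have hx : β' ^ (-(κ / 2)) ≤ β ^ (-(κ / 2)) := Real.rpow_le_rpow_of_nonpos hβpos hββ' (by linarith)
  have main := jeffreys_arith (c := 3 * (D : ℝ) / 2) hβpos hββ' h2 k1 k2 hx (le_max_right _ _)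
  linarith [main]

end JeffreysRate

end Summit.QuantumFields.YangMills.Theorems.EntropyBudgetEquipartition.ScaleEntropy

end
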